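import Literature.NumberTheory.Transcendental.KZBetaChains
import Literature.NumberTheory.Transcendental.KZGaussMultiplicationChain

/-!
# Route GenusOneIterated — support item `LegendreLemniscatic`, helper 1: `a·β(a,1) ∼ [pt, 1]`

Helper for the support item `LegendreLemniscatic` (stmt-KontsevichZagierPeriods-6781) of route
`GenusOneIterated` (Legendre's relation `ω₁η₁ = π` of the lemniscatic curve inside the
Kontsevich–Zagier calculus of moves). The proof of that item runs through the Beta product
`π = ¼·B(¼,½)·B(¾,½) = ¼·B(¼,1)·B(½,½)` (Dirichlet's re-association at `(a,b,c) = (¼,½,½)`); the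
only Newton–Leibniz move of the whole chain is the one proved here, `∫₀¹ a t^{a-1} dt = 1`:

* `betaFirstOne_constMul_equivalent_unit` — for a rational `a > 0` and a representation `β` PINNED
  as the Beta representation `β(a,1) = [(0,1), t^{a-1}(1-t)^{1-1}]`, the scaled representation
  `a·β = β.constMul a` is `KZ.Equivalent` to the unit `[pt, 1]`: ONE Newton–Leibniz move over the
  point (rule 3, primitive `F(t) = t^a` on the closed slab `[0,1]`, `F(1) − F(0) = 1`), the null
  boundary `{0,1}` (rule 1a) and agreement of the integrands on `(0,1)` (rule 1b); pattern of
  `KZ.betaTranslation_equivalent` / `KZ.BallPeeling.betaOne_equivalent_unit_constMul`;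
* `toFormalPeriod_unit_constMul_mul_betaFirstOne` — the same in the formal period ring
  `P = KZ.FormalPeriodRing`: `⟦[pt, a]⟧ · ⟦β(a,1)⟧ = 1`.

No definitions are introduced; pure proof file.

References: M. Kontsevich, D. Zagier, *Periods* (2001), §1.2 rules (1), (3); G. Andrews, R. Askey,
R. Roy, *Special Functions* (1999), §1.1 (`B(a,1) = 1/a`).
-/

noncomputable section

-- `Summit.<Summit>.<Sub>` with Sub = Summit (single-conjunct summit, D-0017) duplicates the segment.
set_option linter.dupNamespace false

namespace Summit.KontsevichZagierPeriods.KontsevichZagierPeriods.Theorems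

open MeasureTheory Set
open Literature.NumberTheory.Transcendental
open Literature.NumberTheory.Transcendental.KZ
open Literature.ModelTheory.ExponentialFields (IsSemialgebraic isSemialgebraic_univ)
open MvPolynomial (aeval X C)

/-- **`a · β(a,1) = [(0,1), a·t^{a-1}] ∼ [pt, 1]`** (`0 < a ∈ ℚ`) for a representation `β` pinned as
the Beta representation `β(a, 1)`: ONE Newton–Leibniz move over the point `ℝ⁰` (band `[0,1]`,
primitive `F(t) = t^a`, continuous on `[0,1]` since `a > 0`, `F(1) − F(0) = 1`), the null boundary
`{0, 1}` and one integrand-additivity move on `(0,1)`. Value identity `a · B(a,1) = 1`.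
[cite: KontsevichZagier2001, §1.2 rule (3)] -/
theorem betaFirstOne_constMul_equivalent_unit (a : ℚ) (ha : 0 < a) (β : IntegralRep 1)
    (hβd : β.domain = {t | t 0 ∈ Set.Ioo (0:ℝ) 1})
    (hβi : Set.EqOn β.integrand
      (fun t => (t 0) ^ ((a : ℝ) - 1) * (1 - t 0) ^ (((1 : ℚ) : ℝ) - 1)) β.domain)
    (h : IsAlgebraic ℚ ((a : ℚ) : ℝ)) :
    Equivalent (β.constMul (a : ℝ) h) IntegralRep.unit := by
  have ha' : (a : ℝ) ≠ 0 := by exact_mod_cast ha.ne'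
  have haR : (0 : ℝ) < a := by exact_mod_cast ha
  -- the derivative of the primitive `t^a`, extended by `0` to the closed interval
  set g : ℝ → ℝ := fun t => if t ∈ Set.Ioo (0:ℝ) 1 then (a : ℝ) * t ^ ((a : ℝ) - 1) else 0
    with hgdef
  have hI : IntegrableOn (fun t : ℝ => t ^ ((a : ℝ) - 1)) (Set.Ioo 0 1) := by
    have h1 := (Literature.Analysis.SpecialFunctions.Selberg.integrableOn_Ioo_rpow_mul_one_sub_rpow_and_integral_eq
      haR one_pos).1
    refine h1.congr_fun (fun t _ => ?_) measurableSet_Ioo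
    simp only [sub_self, Real.rpow_zero, mul_one]
  have hgi : IntegrableOn g (Set.Icc (0:ℝ) 1) := by
    rw [integrableOn_Icc_iff_integrableOn_Ioo]
    refine IntegrableOn.congr_fun (hI.const_mul (a : ℝ)) (fun t ht => ?_) measurableSet_Ioo
    simp only [hgdef, if_pos ht]
  have hg_sa : IsSemialgebraicFunOn ℚ {x : Fin 1 → ℝ | x 0 ∈ Set.Icc (0:ℝ) 1}
      (fun x : Fin 1 → ℝ => g (x 0)) := by
    refine isSemialgebraicFunOn_Icc_of_Ioo ?_ 0 0 (fun x hx => ?_) (fun x hx => ?_)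
    · refine (isSemialgebraicFunOn_const_mul_rpow_mul_rpow a (a - 1) 0).congr fun x hx => ?_
      have hx' : x 0 ∈ Set.Ioo (0:ℝ) 1 := hx
      simp only [hgdef, if_pos hx', Rat.cast_sub, Rat.cast_one, Rat.cast_zero, Real.rpow_zero,
        mul_one]
    · have : x 0 ∉ Set.Ioo (0:ℝ) 1 := fun h' => by rw [hx] at h'; exact lt_irrefl _ h'.1
      simp only [hgdef, if_neg this, Rat.cast_zero]
    · have : x 0 ∉ Set.Ioo (0:ℝ) 1 := fun h' => by rw [hx] at h'; exact lt_irrefl _ h'.2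
      simp only [hgdef, if_neg this, Rat.cast_zero]
  -- the band representation `D = [[0,1], g]`
  obtain ⟨D, hDd, hDi⟩ : ∃ D : IntegralRep 1, D.domain = {x : Fin 1 → ℝ | x 0 ∈ Set.Icc (0:ℝ) 1} ∧
      D.integrand = fun x => g (x 0) :=
    ⟨⟨_, _, isSemialgebraic_setOf_apply_mem_Icc, hg_sa, integrableOn_setOf_apply_mem_iff.2 hgi⟩,
      rfl, rfl⟩
  -- the primitive `F(t) = t^a` is `ℚ`-semialgebraic on `[0,1]`
  have hF_sa : IsSemialgebraicFunOn ℚ {x : Fin 1 → ℝ | x 0 ∈ Set.Icc (0:ℝ) 1}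
      (fun z : Fin 1 → ℝ => (z 0) ^ (a : ℝ)) := by
    refine isSemialgebraicFunOn_Icc_of_Ioo ?_ 0 1 (fun x hx => ?_) (fun x hx => ?_)
    · exact (isSemialgebraicFunOn_const_mul_rpow_mul_rpow 1 a 0).congr fun x _ => by
        simp only [Rat.cast_one, one_mul, Rat.cast_zero, Real.rpow_zero, mul_one]
    · simp only [hx, Real.zero_rpow ha', Rat.cast_zero]
    · simp only [hx, Real.one_rpow, Rat.cast_one]
  -- (1) Newton–Leibniz over the point: `[D] − [pt, 1]`
  have hNL : of D - of IntegralRep.unit ∈ newtonLeibnizRel := by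
    refine ⟨0, D, IntegralRep.unit, fun _ => ((0:ℕ):ℝ), fun _ => ((0:ℕ):ℝ) + 1,
      fun z => (z (Fin.last 0)) ^ (a : ℝ), by rw [hDd]; exact hF_sa,
      by rw [IntegralRep.unit_domain]; exact isSemialgebraicFunOn_natCast isSemialgebraic_univ 0,
      ?_, fun _ _ => by simp, ?_, ?_, ?_, ?_, rfl⟩
    · rw [IntegralRep.unit_domain]
      exact (isSemialgebraicFunOn_aeval isSemialgebraic_univ
        (((0:ℕ) : MvPolynomial (Fin 0) ℚ) + 1)).congr fun x _ => by simp
    · rw [hDd, IntegralRep.unit_domain]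
      ext z
      simp only [mem_univ, true_and, mem_setOf_eq, mem_Icc, Nat.cast_zero, zero_add]
      rfl
    · intro x _
      simp only [Fin.snoc_last, Nat.cast_zero, zero_add]
      exact continuousOn_id.rpow_const fun t _ => Or.inr haR.le
    · intro x _ t ht
      simp only [Nat.cast_zero, zero_add] at ht
      simp only [Fin.snoc_last, hDi]
      rw [show (0 : Fin 1) = Fin.last 0 from rfl, Fin.snoc_last]
      have hgt : g t = (a : ℝ) * t ^ ((a : ℝ) - 1) := by simp only [hgdef, if_pos ht]
      rw [hgt]
      exact Real.hasDerivAt_rpow_const (Or.inl ht.1.ne')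
    · intro x _
      simp only [IntegralRep.unit_integrand, Fin.snoc_last, Nat.cast_zero, zero_add,
        Real.one_rpow, Real.zero_rpow ha', sub_zero]
  have hD_unit : of D - of IntegralRep.unit ∈ relations := newtonLeibnizRel_subset_relations hNL
  -- (2) the null boundary `{0, 1}`
  have hsub : {x : Fin 1 → ℝ | x 0 ∈ Set.Ioo (0:ℝ) 1} ⊆ D.domain := by
    rw [hDd]
    exact fun x hx => ⟨hx.1.le, hx.2.le⟩
  have h2 : of D - of (D.restrict _ BallPeeling.isSemialgebraic_posIoo hsub) ∈ relations :=
    D.of_sub_of_restrict_mem_relations BallPeeling.isSemialgebraic_posIoo hsub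
      (by rw [hDd]; exact volume_setOf_Icc_diff_Ioo)
  -- (3) same domain, same integrand on it
  have h3 : of (β.constMul (a : ℝ) h) -
      of (D.restrict _ BallPeeling.isSemialgebraic_posIoo hsub) ∈ relations := by
    refine of_sub_of_mem_relations_of_eqOn
      (by rw [IntegralRep.domain_restrict, IntegralRep.domain_constMul, hβd]) fun x hx => ?_
    have hx' : x 0 ∈ Set.Ioo (0:ℝ) 1 := by
      rw [IntegralRep.domain_constMul, hβd] at hx; exact hx
    rw [IntegralRep.integrand_constMul, IntegralRep.integrand_restrict, hDi]
    dsimp only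
    rw [hβi (by rw [hβd]; exact hx')]
    simp only [hgdef, if_pos hx', Rat.cast_one, sub_self, Real.rpow_zero, mul_one]
  have : of (β.constMul (a : ℝ) h) - of IntegralRep.unit =
      (of (β.constMul (a : ℝ) h) - of (D.restrict _ BallPeeling.isSemialgebraic_posIoo hsub)) -
        (of D - of (D.restrict _ BallPeeling.isSemialgebraic_posIoo hsub)) +
        (of D - of IntegralRep.unit) := by abel
  rw [Equivalent, this]
  exact relations.add_mem (relations.sub_mem h3 h2) hD_unit

/-- **`⟦[pt, a]⟧ · ⟦β(a,1)⟧ = 1` in the formal period ring** `P = KZ.FormalPeriodRing` (`0 < a ∈ ℚ`,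
`β` pinned as `β(a,1)`): `⟦[pt,a]⟧·⟦β⟧ = ⟦a·β⟧` (`KZ.toFormalPeriod_of_constMul`) and
`a·β ∼ [pt, 1]` (`betaFirstOne_constMul_equivalent_unit`). [cite: KontsevichZagier2001, §4.1] -/
theorem toFormalPeriod_unit_constMul_mul_betaFirstOne (a : ℚ) (ha : 0 < a) (β : IntegralRep 1)
    (hβd : β.domain = {t | t 0 ∈ Set.Ioo (0:ℝ) 1})
    (hβi : Set.EqOn β.integrand
      (fun t => (t 0) ^ ((a : ℝ) - 1) * (1 - t 0) ^ (((1 : ℚ) : ℝ) - 1)) β.domain)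
    (h : IsAlgebraic ℚ ((a : ℚ) : ℝ)) :
    toFormalPeriod (of (IntegralRep.unit.constMul (a : ℝ) h)) * toFormalPeriod (of β) = 1 := by
  rw [← toFormalPeriod_of_constMul, ← toFormalPeriod_of_unit]
  exact (betaFirstOne_constMul_equivalent_unit a ha β hβd hβi h).toFormalPeriod_eq

end Summit.KontsevichZagierPeriods.KontsevichZagierPeriods.Theorems
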